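import Summits.BirchSwinnertonDyer.BirchSwinnertonDyer.Theorems.SignedLowerHalvesKobayashiLowerHalfSemistableDefmuAssembly
import HarnessLib

/-!
# Line «defmu» of crux 2 `KobayashiLowerHalfSemistable` (stmt-BirchSwinnertonDyer-19000): the crux BODY from the four
# registered stub signatures VERBATIM, and the sharpest named-fact form of the `5 ≤ p` half

Route-independent `Theorems` file of the cell `bsd-ssimc`, seat `bsd-line-slh-p2` (LEAD of crux 2, gen 9); companion of
`…SemistableDefmuAssembly.lean` (the `μ`-transfer, the descent, the `5 ≤ p` branch). HONEST FRAMING: nothing about any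
curve is asserted, NO summit statement is proved, BSD / the crux is NOT proved; every theorem is an IMPLICATION from
hypotheses displayed in full.

* `exists_kobayashiLowerDivisibility_of_stubs` — the `5 ≤ p` half from the three registered stub signatures of the skeleton
  of record `Lines/defmu.lean` (sha256 457fecb9…) that it uses, VERBATIM: `stub_ramifiedLevelPrimeR` (S1aʳ),
  `stub_definitePackageMu` (Cμ), `stub_namedInputsTwo` (`NamedInputs₂`, the bundle of six named facts).
* `kobayashiLowerHalfSemistable_body_of_stubs` — the BODY of the route decl
  `Theses.SignedLowerHalves.KobayashiLowerHalfSemistable` (`∀ W p, p ≠ 2 → ClassX6 W p → ∃ ε, KobayashiLowerDivisibility W p ε`;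
  this file does not import the route file) from the FOUR registered stub signatures verbatim (+ `stub_threeResidual`, S7,
  the `p = 3` residual; the odd primes are `{3} ∪ {≥ 5}`). So the by-name closer of the item, once the four stubs are
  theorems `T1a TC TN T3`, is: `theorem … : KobayashiLowerHalfSemistable := kobayashiLowerHalfSemistable_body_of_stubs T1a TC TN T3`.
* `exists_kobayashiLowerDivisibility_of_levelLowering` — the sharpest NAMED form of the `5 ≤ p` half available in the
  tree today: S1aʳ replaced by its two PUBLISHED named facts (modularity `exists_isNewformOf`, Diamond 1995 / Ribet 1990
  level lowering `diamond1995_refinedSerre`, via `SemistableDefiniteFrameData.ramifiedLevelPrimeR_of_levelLowering`,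
  p625644): EIGHT named facts ⊕ the ONE unfolded hypothesis Cμ ⟹ the `5 ≤ p` half. Cμ is not reducible in the kernel
  to the tree's PRE binder `props118_27_519_exists_signedTwoVariablePackage_supersingular_PRE` ⊕ any `μ`-statement (its
  (P1)–(P3) do not pin `𝓛^∘(0,T₂)` up to unit content — LEAD gen 8, `PICKED.md` addendum 3 (b)); a reduction needs a
  characterising interpolation predicate for the two-variable signed function (definition item
  `defn-SignedLFunctionTwoVariable`, closed SUBSUMED 2026-08-27; to be refiled when a consumer exists — this is the consumer).

Kernel state of the crux after this file: UNCHANGED (OPEN; PRE). Nothing of BSTW is asserted.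

References: [BurungaleSkinnerTianWan2024] arXiv:2409.01350v2 §2.2.2–§2.3, Props. 1.18/2.7/5.19, Thm. 6.17, Thm. 9.24,
Thm. 1.3 (p = 3); [Kobayashi2003] Conj. (p. 2), Thm. 1.2, Thm. 4.1; [Ribet1990] Thm. 1.1; [Diamond1995RefinedSerre] Thm. 1.1;
[PollackWeston2011] Thm. 2.5; [Vatsal2003] Thm. 1.1; cell files `Cruxes/KobayashiLowerHalfSemistable/{Lines/defmu.lean, PICKED.md}`.
-/

-- D-0017: single-problem summit, the namespace repeats the problem name by design.
set_option linter.dupNamespace false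
set_option autoImplicit false

noncomputable section

open scoped Classical

open NumberField IsDedekindDomain Field CongruenceSubgroup
open Literature.NumberTheory.GaloisRepresentations
open Literature.NumberTheory.EllipticCurves Literature.NumberTheory.EllipticCurves.BurungaleSkinnerTianWan2024
open Literature.NumberTheory.EllipticCurves.ModularForms

namespace Summit.BirchSwinnertonDyer.BirchSwinnertonDyer.Theorems.SemistableDefmuAssemblyStubs

open Summit.BirchSwinnertonDyer.BirchSwinnertonDyer.Theorems.SemistableDefmuAssembly

/-- **The `5 ≤ p` half of crux 2 from the registered stub signatures VERBATIM** (`h1a` = `stub_ramifiedLevelPrimeR`,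
`hC` = `stub_definitePackageMu`, `h6` = `stub_namedInputsTwo` of `Lines/defmu.lean`, sha256 457fecb9…): for every globally
minimal `W/ℚ`, prime `p ≠ 2` with `ClassX6 W p` and `5 ≤ p`, `∃ ε, KobayashiLowerDivisibility W p ε`. Unbundles `h6` and calls
`SemistableDefmuAssembly.exists_kobayashiLowerDivisibility_of_package`. CONDITIONAL on the displayed hypotheses (two of the
six bundled facts are PREPRINT binders); closes nothing. [cite: BurungaleSkinnerTianWan2024, §2.3 proof of Thm. (KoMC_r)]
[cite: Kobayashi2003, Conjecture (Main Conjecture) (p. 2)] -/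
theorem exists_kobayashiLowerDivisibility_of_stubs
    (h1a :
      ∀ (p : ℕ) [Fact p.Prime] (W : WeierstrassCurve ℚ) [W.IsElliptic] [W.IsGloballyMinimal],
        5 ≤ p → Rank1Residual.ClassX6 W p →
        ∃ q₀ : ℕ, q₀.Prime ∧ (q₀ : ℤ) ∣ W.conductorNorm ℤ ∧ ¬ ((p : ℤ) ∣ padicValRat q₀ W.Δ))
    (hC :
      ∀ {p : ℕ} [Fact p.Prime] (ι : PadicAlgCl p ≃+* ℂ) (W : WeierstrassCurve ℚ) [W.IsElliptic]
        [W.IsGloballyMinimal] (K : Type) [Field K] [NumberField K] (v vbar : HeightOneSpectrum (𝓞 K))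
        (κ₁ κ₂ : ZpExtension K p) (γ₁ γ₂ : absoluteGaloisGroup K)
        [Fact (ZpExtension.IsTopGeneratorPair κ₁ κ₂ γ₁ γ₂)] {N : ℕ} [NeZero N] (f : CuspForm (Gamma0 N) 2)
        [NeZero (NumberField.discr K).natAbs],
        IsNewformOf W f → (N : ℤ) = W.conductorNorm ℤ → p ≠ 2 → ¬ (p : ℤ) ∣ W.conductorNorm ℤ →
        W.frobeniusTrace p = 0 →
        IsImaginaryQuadratic K → ((Ideal.span {(p : ℤ)}).primesOver (𝓞 K)).ncard = 2 →
        ((p : ℕ) : 𝓞 K) ∈ v.asIdeal → ((p : ℕ) : 𝓞 K) ∈ vbar.asIdeal → vbar ≠ v →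
        (∀ (w : InfinitePlace K) (k : 𝓞 K), k ∈ v.asIdeal ↔ ‖ι.symm (w.embedding (k : K))‖ < 1) →
        IsCoprime (N : ℤ) (NumberField.discr K) →
        -- ⟨definite-CR datum, rev 5: X6 at 5 ≤ p; ONE prime q₀ ∥ N inert in K, every other ℓ ∣ N split; `2` split or
        --  `2 ∣ N` ((spl) of BSTW Thm 9.24); (CR, RAMIFIED branch only) `p ∤ v_{q₀}(Δ_W)` (ρ̄ ramified at q₀, `p ∤ c_{q₀}`)⟩
        5 ≤ p → Rank1Residual.ClassX6 W p →
        ∀ q₀ : ℕ, q₀.Prime → q₀ ∣ N → ¬ (q₀ ^ 2 ∣ N) →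
          ((Ideal.span {(q₀ : ℤ)}).primesOver (𝓞 K)).ncard = 1 →
          (∀ ℓ : ℕ, ℓ.Prime → ℓ ∣ N → ℓ ≠ q₀ → ((Ideal.span {(ℓ : ℤ)}).primesOver (𝓞 K)).ncard = 2) →
          (((Ideal.span {(2 : ℤ)}).primesOver (𝓞 K)).ncard = 2 ∨ 2 ∣ N) →
          ¬ ((p : ℤ) ∣ padicValRat q₀ W.Δ) →
        (∀ ρ : ModPGaloisRep K (ZMod p) 2, (W.baseChange K).IsTorsionGaloisRep p ρ →
          FramedRep.IsAbsolutelyIrreducible ρ) →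
        κ₁.IsCyclotomic → κ₂.IsAnticyclotomic →
        ∀ (Ω δ : ℂ) (Ωp : (unrIntegers p)ˣ) (LK G : PowerSeries (PowerSeries (PadicComplexInt p))),
          Ω ≠ 0 → (δ ^ 2 = (NumberField.discr K : ℂ) ∨ δ ^ 2 = -(NumberField.discr K : ℂ)) →
          IsKatzMeasure₂ ι v vbar ∅ κ₁ κ₂ γ₁⁻¹ γ₂⁻¹ 1 Ω δ ((Ωp : unrIntegers p) : PadicComplex p) LK →
          IsGreenbergLFunctionAnyRoot₂ ι v vbar κ₁ κ₂ γ₁⁻¹ γ₂⁻¹ f (NumberField.discr K).natAbs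
            (NumberField.classNumber K) LK G →
        ∀ J : ℤ_[p] →+* PadicComplexInt p,
          (∀ x : ℤ_[p], ((J x : PadicComplexInt p) : PadicComplex p) = ((x : ℚ_[p]) : PadicComplex p)) →
        ∀ ε : ℤˣ,
        ∃ xi Lsig : PowerSeries (PowerSeries (PadicComplexInt p)),
          GreenbergVatsal2000.HasUnitContent (UnrSeries₂.minus Lsig) ∧
          (Ideal.span {xi * G} =
              (WeierstrassCurve.XGr₂.charIdeal (W.baseChange K) p κ₁ κ₂ vbar γ₁ γ₂).map
                  (IwasawaAlgebra₂.toUnr₂ p J) * Ideal.span {Lsig} ∧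
          ∀ (κ : ZpExtension ℚ p) (γ : absoluteGaloisGroup ℚ), κ.IsCyclotomic → κ.IsTopGenerator γ →
            IsCyclotomicVariable p γ →
            (∃ ζ : ℤ_[p]ˣ, IsOfFinOrder ζ ∧
              GaloisRep.cyclotomicCharacter ℚ p γ * ζ = GaloisRep.cyclotomicCharacter K p γ₁) →
            ∀ (W₂ : WeierstrassCurve ℚ) [W₂.IsElliptic] [W₂.IsGloballyMinimal]
              (C₂ : WeierstrassCurve.VariableChange ℚ),
              C₂ • W₂ = W.quadraticTwist (NumberField.discr K : ℚ) →
              (∀ (D₁ : Kobayashi2003.SignedSelmerDualData W κ γ ε)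
                  (D₂ : Kobayashi2003.SignedSelmerDualData W₂ κ γ ε) (g₁ g₂ : IwasawaAlgebra p),
                  D₁.charIdeal = Ideal.span {g₁} → D₂.charIdeal = Ideal.span {g₂} →
                  UnrSeries₂.plus xi ∣ PowerSeries.map J (g₁ * g₂)) ∧
              (∀ {N₂ : ℕ} [NeZero N₂] (f₂ : CuspForm (Gamma0 N₂) 2), IsNewformOf W₂ f₂ →
                ∀ (L₁ L₂ : IwasawaAlgebra p), Kobayashi2003.IsSignedPAdicLFunction f p ε L₁ →
                  Kobayashi2003.IsSignedPAdicLFunction f₂ p ε L₂ →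
                  ∃ u : PowerSeries (PadicComplexInt p), IsUnit u ∧
                    UnrSeries₂.plus Lsig = u * PowerSeries.map J (L₁ * L₂))))
    (h6 :
      (thm617_exists_isGreenbergLFunctionAnyRoot₂_supersingular_PRE ∧
        Kobayashi2003.thm12_signedSelmerDual_finite_torsion ∧ Kobayashi2003.thm41_signedCharIdeal_divisibility ∧
        nonempty_modularParametrizationData ∧ realPeriodRat_eq_unit_mul_plusPeriod) ∧
        thm924_greenberg_dvd_charIdealXGr₂_awayFromCyc_OPEN)
    (W : WeierstrassCurve ℚ) [W.IsElliptic] [W.IsGloballyMinimal] (p : ℕ) [Fact p.Prime]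
    (hp : p ≠ 2) (hX : Rank1Residual.ClassX6 W p) (h5p : 5 ≤ p) :
    ∃ ε : ℤˣ, Summit.BirchSwinnertonDyer.Rank1Residual.Supersingular.KobayashiLowerDivisibility W p ε := by
  obtain ⟨⟨h617, h12, h41, hmod, hper⟩, h924⟩ := h6
  exact exists_kobayashiLowerDivisibility_of_package h1a hC h617 h12 h41 hmod hper h924 W p hp hX h5p

/-- **The BODY of crux 2 `Theses.SignedLowerHalves.KobayashiLowerHalfSemistable` from the FOUR registered stub signatures
VERBATIM** (`h1a` = `stub_ramifiedLevelPrimeR`, `hC` = `stub_definitePackageMu`, `h6` = `stub_namedInputsTwo`, `h7` =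
`stub_threeResidual`; skeleton of record `Lines/defmu.lean`, sha256 457fecb9…): for every globally minimal `W/ℚ` and prime
`p ≠ 2` with `ClassX6 W p`, `∃ ε, KobayashiLowerDivisibility W p ε` — `5 ≤ p` by `exists_kobayashiLowerDivisibility_of_stubs`,
`p = 3` by `h7` (the odd primes are `{3} ∪ {≥ 5}`; `interval_cases`), exactly as the skeleton's `KobayashiLowerHalfSemistable_of`.
The conclusion is the route decl's body spelled out (this file does not import the route file); the by-name closer of
stmt-BirchSwinnertonDyer-19000 is `kobayashiLowerHalfSemistable_body_of_stubs T1a TC TN T3` once the stubs are theorems.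
CONDITIONAL; closes nothing; the item stays OPEN (PRE). [cite: BurungaleSkinnerTianWan2024, Thm. 1.3, §2.3]
[cite: Kobayashi2003, Conjecture (Main Conjecture) (p. 2)] -/
theorem kobayashiLowerHalfSemistable_body_of_stubs
    (h1a :
      ∀ (p : ℕ) [Fact p.Prime] (W : WeierstrassCurve ℚ) [W.IsElliptic] [W.IsGloballyMinimal],
        5 ≤ p → Rank1Residual.ClassX6 W p →
        ∃ q₀ : ℕ, q₀.Prime ∧ (q₀ : ℤ) ∣ W.conductorNorm ℤ ∧ ¬ ((p : ℤ) ∣ padicValRat q₀ W.Δ))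
    (hC :
      ∀ {p : ℕ} [Fact p.Prime] (ι : PadicAlgCl p ≃+* ℂ) (W : WeierstrassCurve ℚ) [W.IsElliptic]
        [W.IsGloballyMinimal] (K : Type) [Field K] [NumberField K] (v vbar : HeightOneSpectrum (𝓞 K))
        (κ₁ κ₂ : ZpExtension K p) (γ₁ γ₂ : absoluteGaloisGroup K)
        [Fact (ZpExtension.IsTopGeneratorPair κ₁ κ₂ γ₁ γ₂)] {N : ℕ} [NeZero N] (f : CuspForm (Gamma0 N) 2)
        [NeZero (NumberField.discr K).natAbs],
        IsNewformOf W f → (N : ℤ) = W.conductorNorm ℤ → p ≠ 2 → ¬ (p : ℤ) ∣ W.conductorNorm ℤ →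
        W.frobeniusTrace p = 0 →
        IsImaginaryQuadratic K → ((Ideal.span {(p : ℤ)}).primesOver (𝓞 K)).ncard = 2 →
        ((p : ℕ) : 𝓞 K) ∈ v.asIdeal → ((p : ℕ) : 𝓞 K) ∈ vbar.asIdeal → vbar ≠ v →
        (∀ (w : InfinitePlace K) (k : 𝓞 K), k ∈ v.asIdeal ↔ ‖ι.symm (w.embedding (k : K))‖ < 1) →
        IsCoprime (N : ℤ) (NumberField.discr K) →
        -- ⟨definite-CR datum, rev 5: X6 at 5 ≤ p; ONE prime q₀ ∥ N inert in K, every other ℓ ∣ N split; `2` split or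
        --  `2 ∣ N` ((spl) of BSTW Thm 9.24); (CR, RAMIFIED branch only) `p ∤ v_{q₀}(Δ_W)` (ρ̄ ramified at q₀, `p ∤ c_{q₀}`)⟩
        5 ≤ p → Rank1Residual.ClassX6 W p →
        ∀ q₀ : ℕ, q₀.Prime → q₀ ∣ N → ¬ (q₀ ^ 2 ∣ N) →
          ((Ideal.span {(q₀ : ℤ)}).primesOver (𝓞 K)).ncard = 1 →
          (∀ ℓ : ℕ, ℓ.Prime → ℓ ∣ N → ℓ ≠ q₀ → ((Ideal.span {(ℓ : ℤ)}).primesOver (𝓞 K)).ncard = 2) →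
          (((Ideal.span {(2 : ℤ)}).primesOver (𝓞 K)).ncard = 2 ∨ 2 ∣ N) →
          ¬ ((p : ℤ) ∣ padicValRat q₀ W.Δ) →
        (∀ ρ : ModPGaloisRep K (ZMod p) 2, (W.baseChange K).IsTorsionGaloisRep p ρ →
          FramedRep.IsAbsolutelyIrreducible ρ) →
        κ₁.IsCyclotomic → κ₂.IsAnticyclotomic →
        ∀ (Ω δ : ℂ) (Ωp : (unrIntegers p)ˣ) (LK G : PowerSeries (PowerSeries (PadicComplexInt p))),
          Ω ≠ 0 → (δ ^ 2 = (NumberField.discr K : ℂ) ∨ δ ^ 2 = -(NumberField.discr K : ℂ)) →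
          IsKatzMeasure₂ ι v vbar ∅ κ₁ κ₂ γ₁⁻¹ γ₂⁻¹ 1 Ω δ ((Ωp : unrIntegers p) : PadicComplex p) LK →
          IsGreenbergLFunctionAnyRoot₂ ι v vbar κ₁ κ₂ γ₁⁻¹ γ₂⁻¹ f (NumberField.discr K).natAbs
            (NumberField.classNumber K) LK G →
        ∀ J : ℤ_[p] →+* PadicComplexInt p,
          (∀ x : ℤ_[p], ((J x : PadicComplexInt p) : PadicComplex p) = ((x : ℚ_[p]) : PadicComplex p)) →
        ∀ ε : ℤˣ,
        ∃ xi Lsig : PowerSeries (PowerSeries (PadicComplexInt p)),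
          GreenbergVatsal2000.HasUnitContent (UnrSeries₂.minus Lsig) ∧
          (Ideal.span {xi * G} =
              (WeierstrassCurve.XGr₂.charIdeal (W.baseChange K) p κ₁ κ₂ vbar γ₁ γ₂).map
                  (IwasawaAlgebra₂.toUnr₂ p J) * Ideal.span {Lsig} ∧
          ∀ (κ : ZpExtension ℚ p) (γ : absoluteGaloisGroup ℚ), κ.IsCyclotomic → κ.IsTopGenerator γ →
            IsCyclotomicVariable p γ →
            (∃ ζ : ℤ_[p]ˣ, IsOfFinOrder ζ ∧
              GaloisRep.cyclotomicCharacter ℚ p γ * ζ = GaloisRep.cyclotomicCharacter K p γ₁) →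
            ∀ (W₂ : WeierstrassCurve ℚ) [W₂.IsElliptic] [W₂.IsGloballyMinimal]
              (C₂ : WeierstrassCurve.VariableChange ℚ),
              C₂ • W₂ = W.quadraticTwist (NumberField.discr K : ℚ) →
              (∀ (D₁ : Kobayashi2003.SignedSelmerDualData W κ γ ε)
                  (D₂ : Kobayashi2003.SignedSelmerDualData W₂ κ γ ε) (g₁ g₂ : IwasawaAlgebra p),
                  D₁.charIdeal = Ideal.span {g₁} → D₂.charIdeal = Ideal.span {g₂} →
                  UnrSeries₂.plus xi ∣ PowerSeries.map J (g₁ * g₂)) ∧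
              (∀ {N₂ : ℕ} [NeZero N₂] (f₂ : CuspForm (Gamma0 N₂) 2), IsNewformOf W₂ f₂ →
                ∀ (L₁ L₂ : IwasawaAlgebra p), Kobayashi2003.IsSignedPAdicLFunction f p ε L₁ →
                  Kobayashi2003.IsSignedPAdicLFunction f₂ p ε L₂ →
                  ∃ u : PowerSeries (PadicComplexInt p), IsUnit u ∧
                    UnrSeries₂.plus Lsig = u * PowerSeries.map J (L₁ * L₂))))
    (h6 :
      (thm617_exists_isGreenbergLFunctionAnyRoot₂_supersingular_PRE ∧
        Kobayashi2003.thm12_signedSelmerDual_finite_torsion ∧ Kobayashi2003.thm41_signedCharIdeal_divisibility ∧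
        nonempty_modularParametrizationData ∧ realPeriodRat_eq_unit_mul_plusPeriod) ∧
        thm924_greenberg_dvd_charIdealXGr₂_awayFromCyc_OPEN)
    (h7 :
      ∀ (W : WeierstrassCurve ℚ) [W.IsElliptic] [W.IsGloballyMinimal], Rank1Residual.ClassX6 W 3 →
        ∃ ε : ℤˣ, Summit.BirchSwinnertonDyer.Rank1Residual.Supersingular.KobayashiLowerDivisibility W 3 ε) :
    ∀ (W : WeierstrassCurve ℚ) [W.IsElliptic] [W.IsGloballyMinimal] (p : ℕ) [Fact p.Prime], p ≠ 2 →
      Rank1Residual.ClassX6 W p →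
      ∃ ε : ℤˣ, Summit.BirchSwinnertonDyer.Rank1Residual.Supersingular.KobayashiLowerDivisibility W p ε := by
  intro W _ _ p hpF hp hX
  by_cases h : 5 ≤ p
  · exact exists_kobayashiLowerDivisibility_of_stubs h1a hC h6 W p hp hX h
  · have hlt : p < 5 := Nat.lt_of_not_le h
    have h2le := hpF.out.two_le
    interval_cases p
    · exact absurd rfl hp
    · exact h7 W hX
    · exact absurd hpF.out (by decide)

/-- **The sharpest NAMED form of the `5 ≤ p` half in the tree today: EIGHT named facts ⊕ ONE unfolded hypothesis Cμ.**
S1aʳ is supplied by `SemistableDefiniteFrameData.ramifiedLevelPrimeR_of_levelLowering` (p625644) from modularity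
`exists_isNewformOf` (`hmodN`) and Diamond 1995 / Ribet 1990 level lowering `diamond1995_refinedSerre` (`hLL`), both PUBLISHED
named facts; the other six are those of `exists_kobayashiLowerDivisibility_of_package` (`h617` PRE, `h12`, `h41`, `hmod`,
`hper` PUB, `h924` OPEN). What is NOT a named fact is exactly Cμ (`hC`, registered stub `stub_definitePackageMu` verbatim):
the BSTW package (Props 1.18/2.7/5.19, PRE) at the definite-CR datum ⊕ the anticyclotomic `μ = 0` (Vatsal 2003 / Pollack–Weston
2011 Thm 2.5, PUB) ⊕ the comparison `(𝓛^∘(0,T₂)) = (L^ε_{f,K})` (BSTW II §2.3, PRE) — not reducible in the kernel to the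
tree's binder `props118_27_519_exists_signedTwoVariablePackage_supersingular_PRE`, whose clauses do not pin `𝓛^∘(0,T₂)` up
to unit content. CONDITIONAL (`conditional-result` on eight names + one hypothesis); closes nothing.
[cite: Ribet1990, Thm. 1.1] [cite: Diamond1995RefinedSerre, Thm. 1.1] [cite: BurungaleSkinnerTianWan2024, §2.3 proof of Thm. (KoMC_r)]
[cite: Kobayashi2003, Conjecture (Main Conjecture) (p. 2)] -/
theorem exists_kobayashiLowerDivisibility_of_levelLowering (hmodN : ModularForms.exists_isNewformOf)
    (hLL : Literature.NumberTheory.Automorphic.diamond1995_refinedSerre)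
    (hC :
      ∀ {p : ℕ} [Fact p.Prime] (ι : PadicAlgCl p ≃+* ℂ) (W : WeierstrassCurve ℚ) [W.IsElliptic]
        [W.IsGloballyMinimal] (K : Type) [Field K] [NumberField K] (v vbar : HeightOneSpectrum (𝓞 K))
        (κ₁ κ₂ : ZpExtension K p) (γ₁ γ₂ : absoluteGaloisGroup K)
        [Fact (ZpExtension.IsTopGeneratorPair κ₁ κ₂ γ₁ γ₂)] {N : ℕ} [NeZero N] (f : CuspForm (Gamma0 N) 2)
        [NeZero (NumberField.discr K).natAbs],
        IsNewformOf W f → (N : ℤ) = W.conductorNorm ℤ → p ≠ 2 → ¬ (p : ℤ) ∣ W.conductorNorm ℤ →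
        W.frobeniusTrace p = 0 →
        IsImaginaryQuadratic K → ((Ideal.span {(p : ℤ)}).primesOver (𝓞 K)).ncard = 2 →
        ((p : ℕ) : 𝓞 K) ∈ v.asIdeal → ((p : ℕ) : 𝓞 K) ∈ vbar.asIdeal → vbar ≠ v →
        (∀ (w : InfinitePlace K) (k : 𝓞 K), k ∈ v.asIdeal ↔ ‖ι.symm (w.embedding (k : K))‖ < 1) →
        IsCoprime (N : ℤ) (NumberField.discr K) →
        -- ⟨definite-CR datum, rev 5: X6 at 5 ≤ p; ONE prime q₀ ∥ N inert in K, every other ℓ ∣ N split; `2` split or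
        --  `2 ∣ N` ((spl) of BSTW Thm 9.24); (CR, RAMIFIED branch only) `p ∤ v_{q₀}(Δ_W)` (ρ̄ ramified at q₀, `p ∤ c_{q₀}`)⟩
        5 ≤ p → Rank1Residual.ClassX6 W p →
        ∀ q₀ : ℕ, q₀.Prime → q₀ ∣ N → ¬ (q₀ ^ 2 ∣ N) →
          ((Ideal.span {(q₀ : ℤ)}).primesOver (𝓞 K)).ncard = 1 →
          (∀ ℓ : ℕ, ℓ.Prime → ℓ ∣ N → ℓ ≠ q₀ → ((Ideal.span {(ℓ : ℤ)}).primesOver (𝓞 K)).ncard = 2) →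
          (((Ideal.span {(2 : ℤ)}).primesOver (𝓞 K)).ncard = 2 ∨ 2 ∣ N) →
          ¬ ((p : ℤ) ∣ padicValRat q₀ W.Δ) →
        (∀ ρ : ModPGaloisRep K (ZMod p) 2, (W.baseChange K).IsTorsionGaloisRep p ρ →
          FramedRep.IsAbsolutelyIrreducible ρ) →
        κ₁.IsCyclotomic → κ₂.IsAnticyclotomic →
        ∀ (Ω δ : ℂ) (Ωp : (unrIntegers p)ˣ) (LK G : PowerSeries (PowerSeries (PadicComplexInt p))),
          Ω ≠ 0 → (δ ^ 2 = (NumberField.discr K : ℂ) ∨ δ ^ 2 = -(NumberField.discr K : ℂ)) →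
          IsKatzMeasure₂ ι v vbar ∅ κ₁ κ₂ γ₁⁻¹ γ₂⁻¹ 1 Ω δ ((Ωp : unrIntegers p) : PadicComplex p) LK →
          IsGreenbergLFunctionAnyRoot₂ ι v vbar κ₁ κ₂ γ₁⁻¹ γ₂⁻¹ f (NumberField.discr K).natAbs
            (NumberField.classNumber K) LK G →
        ∀ J : ℤ_[p] →+* PadicComplexInt p,
          (∀ x : ℤ_[p], ((J x : PadicComplexInt p) : PadicComplex p) = ((x : ℚ_[p]) : PadicComplex p)) →
        ∀ ε : ℤˣ,
        ∃ xi Lsig : PowerSeries (PowerSeries (PadicComplexInt p)),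
          GreenbergVatsal2000.HasUnitContent (UnrSeries₂.minus Lsig) ∧
          (Ideal.span {xi * G} =
              (WeierstrassCurve.XGr₂.charIdeal (W.baseChange K) p κ₁ κ₂ vbar γ₁ γ₂).map
                  (IwasawaAlgebra₂.toUnr₂ p J) * Ideal.span {Lsig} ∧
          ∀ (κ : ZpExtension ℚ p) (γ : absoluteGaloisGroup ℚ), κ.IsCyclotomic → κ.IsTopGenerator γ →
            IsCyclotomicVariable p γ →
            (∃ ζ : ℤ_[p]ˣ, IsOfFinOrder ζ ∧
              GaloisRep.cyclotomicCharacter ℚ p γ * ζ = GaloisRep.cyclotomicCharacter K p γ₁) →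
            ∀ (W₂ : WeierstrassCurve ℚ) [W₂.IsElliptic] [W₂.IsGloballyMinimal]
              (C₂ : WeierstrassCurve.VariableChange ℚ),
              C₂ • W₂ = W.quadraticTwist (NumberField.discr K : ℚ) →
              (∀ (D₁ : Kobayashi2003.SignedSelmerDualData W κ γ ε)
                  (D₂ : Kobayashi2003.SignedSelmerDualData W₂ κ γ ε) (g₁ g₂ : IwasawaAlgebra p),
                  D₁.charIdeal = Ideal.span {g₁} → D₂.charIdeal = Ideal.span {g₂} →
                  UnrSeries₂.plus xi ∣ PowerSeries.map J (g₁ * g₂)) ∧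
              (∀ {N₂ : ℕ} [NeZero N₂] (f₂ : CuspForm (Gamma0 N₂) 2), IsNewformOf W₂ f₂ →
                ∀ (L₁ L₂ : IwasawaAlgebra p), Kobayashi2003.IsSignedPAdicLFunction f p ε L₁ →
                  Kobayashi2003.IsSignedPAdicLFunction f₂ p ε L₂ →
                  ∃ u : PowerSeries (PadicComplexInt p), IsUnit u ∧
                    UnrSeries₂.plus Lsig = u * PowerSeries.map J (L₁ * L₂))))
    (h617 : thm617_exists_isGreenbergLFunctionAnyRoot₂_supersingular_PRE)
    (h12 : Kobayashi2003.thm12_signedSelmerDual_finite_torsion)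
    (h41 : Kobayashi2003.thm41_signedCharIdeal_divisibility)
    (hmod : nonempty_modularParametrizationData)
    (hper : realPeriodRat_eq_unit_mul_plusPeriod)
    (h924 : thm924_greenberg_dvd_charIdealXGr₂_awayFromCyc_OPEN)
    (W : WeierstrassCurve ℚ) [W.IsElliptic] [W.IsGloballyMinimal] (p : ℕ) [Fact p.Prime]
    (hp : p ≠ 2) (hX : Rank1Residual.ClassX6 W p) (h5p : 5 ≤ p) :
    ∃ ε : ℤˣ, Summit.BirchSwinnertonDyer.Rank1Residual.Supersingular.KobayashiLowerDivisibility W p ε :=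
  exists_kobayashiLowerDivisibility_of_package
    (SemistableDefiniteFrameData.ramifiedLevelPrimeR_of_levelLowering hmodN hLL) hC h617 h12 h41 hmod hper h924 W p hp
    hX h5p

end Summit.BirchSwinnertonDyer.BirchSwinnertonDyer.Theorems.SemistableDefmuAssemblyStubs

end
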